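import Summits.CriticalPhenomena.SAWScalingLimit.Theorems.SAWDefectDecoherenceBoundaryClosureRInnerZigzagLocal
import Summits.CriticalPhenomena.SAWScalingLimit.Theorems.SAWDefectDecoherenceBoundaryClosureRInnerZigzagInside
import HarnessLib

/-!
# Crux `BoundaryClosureR` (stmt-CriticalPhenomena-14004), line `polygon-parity-squeeze`,
# stub `stub_innerZigzagPolygon` (7a): corners and flat side points of the inside of the boundary
# cycle

Landing target:
`Summits/CriticalPhenomena/SAWScalingLimit/Theorems/SAWDefectDecoherenceBoundaryClosureRInnerZigzagSides.lean`
(`--supports stmt-CriticalPhenomena-14004`; building block C2 of the registered stub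
`stub_innerZigzagPolygon`, the continuum half of the inner-polygon construction (IP)).

Sequel of `…InnerZigzagLocal.lean`, same context (hypotheses `hin`, `hout`, `hΓ`, `hleft`, `hright`,
`hsegΓ`), plus a period `hPd`, `0 < Per` and the two PINNED BALLS: `P ∩ B(p₁, R₁) = {im > im p₁} ∩ B(p₁, R₁)`
and the same at `p₀` (`R₁, R₀ ≥ 4`).  The corners of the construction are the cycle vertices at
distance `≥ 3` from both `p₁`, `p₀`.

* `corner_shape` — the `∃ k k', (∩) ∨ (∪)` form of `IsCornerAt` at every vertex (`vertex_shape`);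
* `near_vertex_halfPlane_out/in` — for a cycle point `z` on the out- or in-edge at distance `d < 1/8`
  from a vertex `y`, with `1/16 ≤ d` unless `y` is flat, `P ∩ B(z, 1/32)` is a zigzag half-plane
  through `z` cut to the ball (`side_ball_geometry`); `edge_halfPlane` — for `z` on an edge at
  parameter `θ ∈ [1/8, 7/8]`, `P ∩ B(z, 1/32) = H_{σ m}(z) ∩ B` (`edge_trichotomy`);
* `pin_halfPlane` — near a pin, a cycle point `w` sees `P ∩ B(w, 1/32) = H₀(w) ∩ B` (upper half-plane);
* `flat_side_points` — **every cycle point at distance `≥ 1/16` from the corners is a flat side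
  point of radius `1/32`**: `∃ κ, P ∩ B(w, 1/32) = H_κ(w) ∩ B(w, 1/32)` — on the middle of an edge by
  `edge_halfPlane`, near a vertex by `near_vertex_halfPlane_out/in` (the vertex is a corner, so
  `d ≥ 1/16`) or by `pin_halfPlane` (the vertex is within `3` of a pin);
* `vertex_mem_frontier` — the vertices of the cycle are on the cycle.

Sources: folklore.  No definition and no named fact is introduced.
-/

noncomputable section

open scoped ComplexConjugate
open Set Metric
open Literature.Probability.LatticeModels
open Literature.Probability.Percolation (triX triY triCell triCellStrict triDir)
open Literature.Probability.RandomPlanarGeometry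
open Summit.CriticalPhenomena.SAWScalingLimit.Theorems.PolygonParitySqueeze.BoundaryWalk

namespace Summit.CriticalPhenomena.SAWScalingLimit.Theorems.PolygonParitySqueeze.InnerZigzag

variable {K : Finset HexVertex} {d₀ : Site 2 × Fin 6} {Per : ℕ}
  (hs : IsSimpleClosedPolygon (bverts K 0 1 d₀ Per)) (h₀ : d₀ ∈ bdDarts K) (hPd : bwalk K d₀ Per = d₀) (hP0 : 0 < Per)
  {V : Set ℂ} (hV : IsOpen V ∧ Disjoint (polygonDomain (bverts K 0 1 d₀ Per) hs).carrier V ∧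
    (polygonDomain (bverts K 0 1 d₀ Per) hs).carrier ∪ V = (frontier (polygonDomain (bverts K 0 1 d₀ Per) hs).carrier)ᶜ ∧
    frontier V = frontier (polygonDomain (bverts K 0 1 d₀ Per) hs).carrier)
  (hK : ∀ y : Site 2, (Finset.univ.filter fun k : Fin 6 => faceL y k ∈ K ∧ faceL y (k + 1) ∉ K).card ≤ 1)
  (hin : ∀ (t : ℕ) (i : Fin 6), faceL ((bwalk K d₀ t).1 + triDir (bwalk K d₀ t).2) i ∈ K →
    triCellStrict (faceL ((bwalk K d₀ t).1 + triDir (bwalk K d₀ t).2) i) ⊆ (polygonDomain (bverts K 0 1 d₀ Per) hs).carrier)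
  (hout : ∀ (t : ℕ) (i : Fin 6), faceL ((bwalk K d₀ t).1 + triDir (bwalk K d₀ t).2) i ∉ K →
    triCellStrict (faceL ((bwalk K d₀ t).1 + triDir (bwalk K d₀ t).2) i) ⊆ V)
  (hΓ : ∀ z ∈ frontier (polygonDomain (bverts K 0 1 d₀ Per) hs).carrier, ∃ t < Per,
    z ∈ triCell (faceL (bwalk K d₀ t).1 (bwalk K d₀ t).2) ∧ z ∈ triCell (faceL (bwalk K d₀ t).1 ((bwalk K d₀ t).2 + 5)) ∧
    faceL (bwalk K d₀ t).1 (bwalk K d₀ t).2 ∈ K ∧ faceL (bwalk K d₀ t).1 ((bwalk K d₀ t).2 + 5) ∉ K)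
  (hleft : ∀ t : ℕ, triCellStrict (faceL (bwalk K d₀ t).1 (bwalk K d₀ t).2) ⊆ (polygonDomain (bverts K 0 1 d₀ Per) hs).carrier)
  (hright : ∀ t : ℕ, triCellStrict (faceL (bwalk K d₀ t).1 ((bwalk K d₀ t).2 + 5)) ⊆ V)
  (hsegΓ : ∀ t : ℕ, segment ℝ (triEmbed (bwalk K d₀ t).1) (triEmbed ((bwalk K d₀ t).1 + triDir (bwalk K d₀ t).2)) ⊆
    frontier (polygonDomain (bverts K 0 1 d₀ Per) hs).carrier)
  {p₁ p₀ : ℂ} {Rb₁ Rb₀ : ℝ} (hRb₁ : 4 ≤ Rb₁) (hRb₀ : 4 ≤ Rb₀)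
  (hpin₁ : (polygonDomain (bverts K 0 1 d₀ Per) hs).carrier ∩ ball p₁ Rb₁ = {w : ℂ | p₁.im < w.im} ∩ ball p₁ Rb₁)
  (hpin₀ : (polygonDomain (bverts K 0 1 d₀ Per) hs).carrier ∩ ball p₀ Rb₀ = {w : ℂ | p₀.im < w.im} ∩ ball p₀ Rb₀)

/-! ### 1. Corners, side points near a vertex, side points on an edge -/

include h₀ hV hK hin hout hΓ in
/-- **Corner shape** (the `IsCornerAt` form): at every vertex of the cycle, for `s ≤ 1/4`,
`P ∩ B(y, s)` is the intersection or the union of two zigzag half-planes through `y`, cut to the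
ball (a flat vertex counts with `k = k'`). [folklore] -/
theorem corner_shape (t : ℕ) {s : ℝ} (hs4 : s ≤ 1 / 4) :
    ∃ k k' : Fin 6,
      (polygonDomain (bverts K 0 1 d₀ Per) hs).carrier ∩ ball (triEmbed ((bwalk K d₀ t).1 + triDir (bwalk K d₀ t).2)) s =
          halfPlane k (triEmbed ((bwalk K d₀ t).1 + triDir (bwalk K d₀ t).2)) ∩
            halfPlane k' (triEmbed ((bwalk K d₀ t).1 + triDir (bwalk K d₀ t).2)) ∩
            ball (triEmbed ((bwalk K d₀ t).1 + triDir (bwalk K d₀ t).2)) s ∨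
        (polygonDomain (bverts K 0 1 d₀ Per) hs).carrier ∩ ball (triEmbed ((bwalk K d₀ t).1 + triDir (bwalk K d₀ t).2)) s =
          (halfPlane k (triEmbed ((bwalk K d₀ t).1 + triDir (bwalk K d₀ t).2)) ∪
            halfPlane k' (triEmbed ((bwalk K d₀ t).1 + triDir (bwalk K d₀ t).2))) ∩
            ball (triEmbed ((bwalk K d₀ t).1 + triDir (bwalk K d₀ t).2)) s := by
  rcases vertex_shape hs h₀ hV hK hin hout hΓ t hs4 with ⟨-, h⟩ | ⟨-, h⟩ | ⟨-, h⟩ | ⟨-, h⟩ | ⟨-, h⟩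
  · exact ⟨_, _, Or.inl h⟩
  · exact ⟨_, _, Or.inl h⟩
  · refine ⟨![0, 3, 5, 1, 2, 4] (bwalk K d₀ t).2, ![0, 3, 5, 1, 2, 4] (bwalk K d₀ t).2, Or.inl ?_⟩
    rw [inter_self]; exact h
  · exact ⟨_, _, Or.inr h⟩
  · exact ⟨_, _, Or.inr h⟩

omit hs h₀ hV hK hin hout hΓ hleft hright hsegΓ in
/-- Yet more `Fin 6` bookkeeping round a vertex. [folklore] -/
theorem fin6_more (k : Fin 6) : k + 2 + 4 = k ∧ k + 3 + 3 = k ∧ k + 1 + 5 = k ∧ k + 1 + 2 = k + 3 ∧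
    k + 5 + 4 = k + 3 ∧ k + 4 + 5 = k + 3 := by
  refine ⟨by rw [add_assoc, show (2 : Fin 6) + 4 = 0 from rfl, add_zero],
    by rw [add_assoc, show (3 : Fin 6) + 3 = 0 from rfl, add_zero],
    by rw [add_assoc, show (1 : Fin 6) + 5 = 0 from rfl, add_zero], by rw [add_assoc]; rfl,
    by rw [add_assoc, show (5 : Fin 6) + 4 = 3 from rfl], by rw [add_assoc, show (4 : Fin 6) + 5 = 3 from rfl]⟩

omit hs h₀ hV hK hin hout hΓ hleft hright hsegΓ in
/-- A ball of radius `1/32` about a point at distance `< 1/8` from `y` lies in `B(y, 1/4)`.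
[folklore] -/
theorem ball_subset_ball_vertex {y z : ℂ} (hz : dist z y < 1 / 8) : ball z (1 / 32) ⊆ ball y (1 / 4) := by
  intro w hw
  rw [mem_ball] at hw ⊢
  linarith [dist_triangle w z y]

omit hs h₀ hV hK hin hout hΓ hleft hright hsegΓ in
/-- Cutting an identity on a ball to a smaller ball inside it. [folklore] -/
theorem inter_eq_of_inter_eq_of_subset {P A : Set ℂ} {B B' : Set ℂ} (h : P ∩ B = A ∩ B) (hB : B' ⊆ B) :
    P ∩ B' = A ∩ B' := by
  rw [← inter_eq_self_of_subset_right hB, ← inter_assoc, ← inter_assoc, h]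

include h₀ hV hK hin hout hΓ in
/-- **Side points near a vertex, on the out-edge**: for `z = y + d·triDir j` (`j` the out-direction
at the head `y` of the dart `t`) with `d < 1/8`, and `1/16 ≤ d` unless `y` is flat, `P ∩ B(z, 1/32)`
is a zigzag half-plane through `z` cut to the ball. [folklore] -/
theorem near_vertex_halfPlane_out (t : ℕ) {d : ℝ} (hd0 : 0 ≤ d) (hd8 : d < 1 / 8)
    (hd16 : (bwalk K d₀ (t + 1)).2 = (bwalk K d₀ t).2 ∨ 1 / 16 ≤ d) :
    ∃ κ : Fin 6,
      (polygonDomain (bverts K 0 1 d₀ Per) hs).carrier ∩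
          ball (triEmbed ((bwalk K d₀ t).1 + triDir (bwalk K d₀ t).2) + (d : ℂ) * triEmbed (triDir (bwalk K d₀ (t + 1)).2)) (1 / 32) =
        halfPlane κ (triEmbed ((bwalk K d₀ t).1 + triDir (bwalk K d₀ t).2) + (d : ℂ) * triEmbed (triDir (bwalk K d₀ (t + 1)).2)) ∩
          ball (triEmbed ((bwalk K d₀ t).1 + triDir (bwalk K d₀ t).2) + (d : ℂ) * triEmbed (triDir (bwalk K d₀ (t + 1)).2)) (1 / 32) := by
  have hshape := vertex_shape hs h₀ hV hK hin hout hΓ t (le_refl (1 / 4 : ℝ))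
  set y := triEmbed ((bwalk K d₀ t).1 + triDir (bwalk K d₀ t).2) with hy
  set k := (bwalk K d₀ t).2 with hk
  set P := (polygonDomain (bverts K 0 1 d₀ Per) hs).carrier with hP
  obtain ⟨n21, n20, n25, n24, n10, n15, n14, n05, n04, n54⟩ := fin6_ne k
  have hr : (0 : ℝ) < 1 / 16 := by norm_num
  have e32 : (1 : ℝ) / 16 / 2 = 1 / 32 := by norm_num
  rcases hshape with ⟨hj, h⟩ | ⟨hj, h⟩ | ⟨hj, h⟩ | ⟨hj, h⟩ | ⟨hj, h⟩ <;> rw [hj] at hd16 ⊢ <;>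
    set z := y + (d : ℂ) * triEmbed (triDir _) with hz
  · have hd : 1 / 16 ≤ d := hd16.resolve_left n20
    have hzy : dist z y < 1 / 8 := by
      rw [dist_eq_norm, hz, add_sub_cancel_left, norm_mul, Complex.norm_real, Real.norm_of_nonneg hd0,
        norm_triEmbed_triDir, mul_one]; exact hd8
    refine ⟨![0, 3, 5, 1, 2, 4] (k + 2), ?_⟩
    rw [inter_eq_of_inter_eq_of_subset h (ball_subset_ball_vertex hzy), ← e32]
    exact inter_halfPlane_inter_ball_eq _ _ hz (level_triDir_sigma (k + 2)) (level_triDir_fan (k + 2)).1 hr hd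
  · have hd : 1 / 16 ≤ d := hd16.resolve_left n10
    have hzy : dist z y < 1 / 8 := by
      rw [dist_eq_norm, hz, add_sub_cancel_left, norm_mul, Complex.norm_real, Real.norm_of_nonneg hd0,
        norm_triEmbed_triDir, mul_one]; exact hd8
    refine ⟨![0, 3, 5, 1, 2, 4] (k + 1), ?_⟩
    rw [inter_eq_of_inter_eq_of_subset h (ball_subset_ball_vertex hzy), ← e32]
    exact inter_halfPlane_inter_ball_eq _ _ hz (level_triDir_sigma (k + 1)) (level_triDir_fan (k + 1)).2.2.1 hr hd
  · have hzy : dist z y < 1 / 8 := by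
      rw [dist_eq_norm, hz, add_sub_cancel_left, norm_mul, Complex.norm_real, Real.norm_of_nonneg hd0,
        norm_triEmbed_triDir, mul_one]; exact hd8
    refine ⟨![0, 3, 5, 1, 2, 4] k, ?_⟩
    rw [inter_eq_of_inter_eq_of_subset h (ball_subset_ball_vertex hzy)]
    rw [halfPlane_eq_of_level_eq_zero (![0, 3, 5, 1, 2, 4] k) (y := y) (z := z)
      (by rw [hz, level_add_smul, level_triDir_sigma, mul_zero])]
  · have hd : 1 / 16 ≤ d := hd16.resolve_left n05.symm
    have hzy : dist z y < 1 / 8 := by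
      rw [dist_eq_norm, hz, add_sub_cancel_left, norm_mul, Complex.norm_real, Real.norm_of_nonneg hd0,
        norm_triEmbed_triDir, mul_one]; exact hd8
    refine ⟨![0, 3, 5, 1, 2, 4] (k + 5), ?_⟩
    rw [inter_eq_of_inter_eq_of_subset h (ball_subset_ball_vertex hzy), ← e32]
    exact union_halfPlane_inter_ball_eq _ _ hz (level_triDir_sigma (k + 5)) (level_triDir_fan (k + 5)).2.2.2.2.1 hr hd
  · have hd : 1 / 16 ≤ d := hd16.resolve_left n04.symm
    have hzy : dist z y < 1 / 8 := by
      rw [dist_eq_norm, hz, add_sub_cancel_left, norm_mul, Complex.norm_real, Real.norm_of_nonneg hd0,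
        norm_triEmbed_triDir, mul_one]; exact hd8
    refine ⟨![0, 3, 5, 1, 2, 4] (k + 4), ?_⟩
    rw [inter_eq_of_inter_eq_of_subset h (ball_subset_ball_vertex hzy), ← e32]
    exact union_halfPlane_inter_ball_eq _ _ hz (level_triDir_sigma (k + 4)) (level_triDir_fan (k + 4)).2.2.2.2.2.2.1 hr hd

include h₀ hV hK hin hout hΓ in
/-- **Side points near a vertex, on the in-edge**: the same for `z = y + d·triDir (k + 3)` (`k` the
in-direction), the side being that of the incoming dart (form `σ k`). [folklore] -/
theorem near_vertex_halfPlane_in (t : ℕ) {d : ℝ} (hd0 : 0 ≤ d) (hd8 : d < 1 / 8)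
    (hd16 : (bwalk K d₀ (t + 1)).2 = (bwalk K d₀ t).2 ∨ 1 / 16 ≤ d) :
    ∃ κ : Fin 6,
      (polygonDomain (bverts K 0 1 d₀ Per) hs).carrier ∩
          ball (triEmbed ((bwalk K d₀ t).1 + triDir (bwalk K d₀ t).2) + (d : ℂ) * triEmbed (triDir ((bwalk K d₀ t).2 + 3))) (1 / 32) =
        halfPlane κ (triEmbed ((bwalk K d₀ t).1 + triDir (bwalk K d₀ t).2) + (d : ℂ) * triEmbed (triDir ((bwalk K d₀ t).2 + 3))) ∩
          ball (triEmbed ((bwalk K d₀ t).1 + triDir (bwalk K d₀ t).2) + (d : ℂ) * triEmbed (triDir ((bwalk K d₀ t).2 + 3))) (1 / 32) := by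
  have hshape := vertex_shape hs h₀ hV hK hin hout hΓ t (le_refl (1 / 4 : ℝ))
  set y := triEmbed ((bwalk K d₀ t).1 + triDir (bwalk K d₀ t).2) with hy
  set k := (bwalk K d₀ t).2 with hk
  set P := (polygonDomain (bverts K 0 1 d₀ Per) hs).carrier with hP
  set z := y + (d : ℂ) * triEmbed (triDir (k + 3)) with hz
  obtain ⟨n21, n20, n25, n24, n10, n15, n14, n05, n04, n54⟩ := fin6_ne k
  obtain ⟨e24, e33, e15, e12, e54, e45⟩ := fin6_more k
  obtain ⟨e0, e11, e21, e31, e41, e51⟩ := fin6_book k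
  obtain ⟨-, -, e42, -, -⟩ := fin6_succ' k
  have hr : (0 : ℝ) < 1 / 16 := by norm_num
  have e32 : (1 : ℝ) / 16 / 2 = 1 / 32 := by norm_num
  have hzy : dist z y < 1 / 8 := by
    rw [dist_eq_norm, hz, add_sub_cancel_left, norm_mul, Complex.norm_real, Real.norm_of_nonneg hd0,
      norm_triEmbed_triDir, mul_one]; exact hd8
  have h0 : (triEmbed (triDir (k + 3)) * conj (innerNormal (![0, 3, 5, 1, 2, 4] k))).re = 0 := by
    have := level_triDir_sigma_add_three (k + 3)
    rwa [e33] at this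
  rcases hshape with ⟨hj, h⟩ | ⟨hj, h⟩ | ⟨hj, h⟩ | ⟨hj, h⟩ | ⟨hj, h⟩ <;> rw [hj] at hd16 <;>
    rw [inter_eq_of_inter_eq_of_subset h (ball_subset_ball_vertex hzy)]
  · have hd : 1 / 16 ≤ d := hd16.resolve_left n20
    refine ⟨![0, 3, 5, 1, 2, 4] k, ?_⟩
    have h1 := (level_triDir_fan (k + 2)).2.1
    rw [e21] at h1
    rw [e24, inter_comm (halfPlane _ _), ← e32]
    exact inter_halfPlane_inter_ball_eq _ _ hz h0 h1 hr hd
  · have hd : 1 / 16 ≤ d := hd16.resolve_left n10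
    refine ⟨![0, 3, 5, 1, 2, 4] k, ?_⟩
    have h1 := (level_triDir_fan (k + 1)).2.2.2.1
    rw [e12] at h1
    rw [e15, inter_comm (halfPlane _ _), ← e32]
    exact inter_halfPlane_inter_ball_eq _ _ hz h0 h1 hr hd
  · refine ⟨![0, 3, 5, 1, 2, 4] k, ?_⟩
    rw [halfPlane_eq_of_level_eq_zero (![0, 3, 5, 1, 2, 4] k) (y := y) (z := z)
      (by rw [hz, level_add_smul, h0, mul_zero])]
  · have hd : 1 / 16 ≤ d := hd16.resolve_left n05.symm
    refine ⟨![0, 3, 5, 1, 2, 4] k, ?_⟩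
    have h1 := (level_triDir_fan (k + 5)).2.2.2.2.2.1
    rw [e54] at h1
    rw [e51, union_comm, ← e32]
    exact union_halfPlane_inter_ball_eq _ _ hz h0 h1 hr hd
  · have hd : 1 / 16 ≤ d := hd16.resolve_left n04.symm
    refine ⟨![0, 3, 5, 1, 2, 4] k, ?_⟩
    have h1 := (level_triDir_fan (k + 4)).2.2.2.2.2.2.2
    rw [e45] at h1
    rw [e42, union_comm, ← e32]
    exact union_halfPlane_inter_ball_eq _ _ hz h0 h1 hr hd

include hV hleft hright hsegΓ in
/-- **Side points on an edge, off its ends**: for `z = triEmbed b + θ·triDir m` on the edge of the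
dart `t = (b, m)` with `θ ∈ [1/8, 7/8]`, `P ∩ B(z, 1/32) = H_{σ m}(z) ∩ B(z, 1/32)`. [folklore] -/
theorem edge_halfPlane (t : ℕ) {θ : ℝ} (hθ1 : 1 / 8 ≤ θ) (hθ2 : θ ≤ 7 / 8) :
    (polygonDomain (bverts K 0 1 d₀ Per) hs).carrier ∩
        ball (triEmbed (bwalk K d₀ t).1 + (θ : ℂ) * triEmbed (triDir (bwalk K d₀ t).2)) (1 / 32) =
      halfPlane (![0, 3, 5, 1, 2, 4] (bwalk K d₀ t).2) (triEmbed (bwalk K d₀ t).1 + (θ : ℂ) * triEmbed (triDir (bwalk K d₀ t).2)) ∩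
        ball (triEmbed (bwalk K d₀ t).1 + (θ : ℂ) * triEmbed (triDir (bwalk K d₀ t).2)) (1 / 32) := by
  set b := (bwalk K d₀ t).1 with hb
  set m := (bwalk K d₀ t).2 with hm
  set P := (polygonDomain (bverts K 0 1 d₀ Per) hs).carrier with hP
  set z := triEmbed b + (θ : ℂ) * triEmbed (triDir m) with hz
  have hPo : IsOpen P := (polygonDomain (bverts K 0 1 d₀ Per) hs).isOpen
  have hseg : segment ℝ (triEmbed b) (triEmbed (b + triDir m)) ⊆ frontier P := hsegΓ t
  have hleft := hleft t
  have hright := hright t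
  ext w
  simp only [mem_inter_iff]
  constructor
  · rintro ⟨hwP, hwB⟩
    refine ⟨?_, hwB⟩
    have hq : 4 * ‖w - z‖ < min θ (1 - θ) := by
      rw [mem_ball, dist_eq_norm] at hwB
      have : (1 : ℝ) / 8 ≤ min θ (1 - θ) := le_min hθ1 (by linarith)
      linarith
    obtain ⟨-, hneg, hzero⟩ := edge_trichotomy b m θ w hq
    rw [mem_halfPlane_iff_level]
    rcases lt_trichotomy 0 ((w - z) * conj (innerNormal (![0, 3, 5, 1, 2, 4] m))).re with h | h | h
    · exact h
    · exfalso
      have : w ∈ P ∩ frontier P := ⟨hwP, hseg (hzero h.symm)⟩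
      rw [hPo.inter_frontier_eq] at this
      exact this
    · exact absurd hwP (Set.disjoint_right.1 hV.2.1 (hright (hneg h)))
  · rintro ⟨hwH, hwB⟩
    refine ⟨?_, hwB⟩
    have hq : 4 * ‖w - z‖ < min θ (1 - θ) := by
      rw [mem_ball, dist_eq_norm] at hwB
      have : (1 : ℝ) / 8 ≤ min θ (1 - θ) := le_min hθ1 (by linarith)
      linarith
    exact hleft ((edge_trichotomy b m θ w hq).1 ((mem_halfPlane_iff_level _ _ _).1 hwH))

/-! ### 2. Pins and flat side points -/

/-- **Near a pin a cycle point sees the upper half-plane.**  If inside `B(c, Rb)` the domain is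
the open upper half-ball, `‖y - c‖ < 3`, `dist w y ≤ 1/8`, `Rb ≥ 4` and `w` is on the cycle, then
`P ∩ B(w, 1/32) = H₀(w) ∩ B(w, 1/32)`. [folklore] -/
theorem pin_halfPlane {c y w : ℂ} {Rb : ℝ} (hRb : 4 ≤ Rb)
    (hpin : (polygonDomain (bverts K 0 1 d₀ Per) hs).carrier ∩ ball c Rb = {w : ℂ | c.im < w.im} ∩ ball c Rb)
    (hy : ‖y - c‖ < 3) (hwy : dist w y ≤ 1 / 8) (hw : w ∈ frontier (polygonDomain (bverts K 0 1 d₀ Per) hs).carrier) :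
    (polygonDomain (bverts K 0 1 d₀ Per) hs).carrier ∩ ball w (1 / 32) = halfPlane 0 w ∩ ball w (1 / 32) := by
  set P := (polygonDomain (bverts K 0 1 d₀ Per) hs).carrier with hP
  have hwc : dist w c < 3 + 1 / 8 := by
    have := dist_triangle w y c; rw [dist_eq_norm y c] at this; linarith
  have hsub : ball w (1 / 32) ⊆ ball c Rb := by
    intro u hu; rw [mem_ball] at hu ⊢; linarith [dist_triangle u w c]
  -- `w` is on the pin line
  have hwim : w.im = c.im := by
    have h1 : w ∈ frontier P ∩ ball c Rb := ⟨hw, by rw [mem_ball]; linarith⟩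
    rw [← frontier_inter_open_inter isOpen_ball, hpin, frontier_inter_open_inter isOpen_ball] at h1
    exact (frontier_lt_subset_eq continuous_const Complex.continuous_im h1.1).symm
  rw [halfPlane_zero, hwim, ← inter_eq_self_of_subset_right hsub, ← inter_assoc, ← inter_assoc, hpin]

omit hs in
/-- The embedded step of a dart: `E(b) + θ • (E(b + d) - E(b)) = E(b) + θ·E(d)`. [folklore] -/
theorem lineMap_edge (b : Site 2) (m : Fin 6) (θ : ℝ) :
    triEmbed b + θ • (triEmbed (b + triDir m) - triEmbed b) = triEmbed b + (θ : ℂ) * triEmbed (triDir m) := by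
  rw [triEmbed_add, add_sub_cancel_left, Complex.real_smul]

omit hs in
/-- The same edge point seen from the head: `E(b) + θ·E(d) = E(b + d) + (1 - θ)·E(d_{+3})`. [folklore] -/
theorem edge_from_head (b : Site 2) (m : Fin 6) (θ : ℝ) :
    triEmbed b + (θ : ℂ) * triEmbed (triDir m) = triEmbed (b + triDir m) + ((1 - θ : ℝ) : ℂ) * triEmbed (triDir (m + 3)) := by
  rw [Literature.Probability.Percolation.triDir_add_three, triEmbed_neg, triEmbed_add]
  push_cast
  ring

include h₀ hPd hP0 hV hK hin hout hΓ hleft hright hsegΓ hRb₁ hRb₀ hpin₁ hpin₀ in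
/-- **Flat side points.**  Every cycle point `w` at distance `≥ 1/16` from the corners (the cycle
vertices at distance `≥ 3` from both pins) is a zigzag flat side point of radius `1/32`.
[folklore] -/
theorem flat_side_points {w : ℂ} (hw : w ∈ frontier (polygonDomain (bverts K 0 1 d₀ Per) hs).carrier)
    (hfar : ∀ t : ℕ, 3 ≤ ‖triEmbed ((bwalk K d₀ t).1 + triDir (bwalk K d₀ t).2) - p₁‖ →
      3 ≤ ‖triEmbed ((bwalk K d₀ t).1 + triDir (bwalk K d₀ t).2) - p₀‖ →
      1 / 16 ≤ dist w (triEmbed ((bwalk K d₀ t).1 + triDir (bwalk K d₀ t).2))) :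
    ∃ κ : Fin 6, (polygonDomain (bverts K 0 1 d₀ Per) hs).carrier ∩ ball w (1 / 32) = halfPlane κ w ∩ ball w (1 / 32) := by
  obtain ⟨t, -, hwseg⟩ := (mem_frontier_iff hs h₀ hPd).1 hw
  rw [segment_eq_image'] at hwseg
  obtain ⟨θ, ⟨hθ0, hθ1⟩, rfl⟩ := hwseg
  dsimp only at hw hfar ⊢
  rw [lineMap_edge] at hw hfar ⊢
  by_cases hθa : θ < 1 / 8
  · -- near the tail vertex, the head of the dart `t' = t + (Per - 1)`
    set t' := t + (Per - 1) with ht'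
    have ht1 : t' + 1 = t + Per := by omega
    have hb : bwalk K d₀ t = bwalk K d₀ (t' + 1) := by rw [ht1, bwalk_add_period hPd]
    have hy : (bwalk K d₀ t).1 = (bwalk K d₀ t').1 + triDir (bwalk K d₀ t').2 := by rw [hb, bwalk_fst_succ h₀]
    set y := triEmbed ((bwalk K d₀ t').1 + triDir (bwalk K d₀ t').2) with hydef
    have hwy : dist (triEmbed (bwalk K d₀ t).1 + (θ : ℂ) * triEmbed (triDir (bwalk K d₀ t).2)) y = θ := by
      rw [hy, dist_eq_norm, add_sub_cancel_left, norm_mul, Complex.norm_real, Real.norm_of_nonneg hθ0,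
        norm_triEmbed_triDir, mul_one]
    by_cases n1 : ‖y - p₁‖ < 3
    · exact ⟨0, pin_halfPlane hs hRb₁ hpin₁ n1 (by rw [hwy]; linarith) hw⟩
    by_cases n0 : ‖y - p₀‖ < 3
    · exact ⟨0, pin_halfPlane hs hRb₀ hpin₀ n0 (by rw [hwy]; linarith) hw⟩
    have hd : 1 / 16 ≤ θ := by rw [← hwy]; exact hfar t' (not_lt.1 n1) (not_lt.1 n0)
    obtain ⟨κ, hκ⟩ := near_vertex_halfPlane_out hs h₀ hV hK hin hout hΓ t' hθ0 hθa (Or.inr hd)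
    refine ⟨κ, ?_⟩
    rw [hy, hb]
    exact hκ
  by_cases hθb : 7 / 8 < θ
  · -- near the head vertex of the dart `t`
    set y := triEmbed ((bwalk K d₀ t).1 + triDir (bwalk K d₀ t).2) with hydef
    rw [edge_from_head] at hw ⊢
    have hwy : dist (y + ((1 - θ : ℝ) : ℂ) * triEmbed (triDir ((bwalk K d₀ t).2 + 3))) y = 1 - θ := by
      rw [dist_eq_norm, add_sub_cancel_left, norm_mul, Complex.norm_real, Real.norm_of_nonneg (by linarith),
        norm_triEmbed_triDir, mul_one]
    by_cases n1 : ‖y - p₁‖ < 3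
    · exact ⟨0, pin_halfPlane hs hRb₁ hpin₁ n1 (by rw [hwy]; linarith) hw⟩
    by_cases n0 : ‖y - p₀‖ < 3
    · exact ⟨0, pin_halfPlane hs hRb₀ hpin₀ n0 (by rw [hwy]; linarith) hw⟩
    have hd : 1 / 16 ≤ 1 - θ := by
      rw [← hwy]
      have := hfar t (not_lt.1 n1) (not_lt.1 n0)
      rwa [edge_from_head] at this
    exact near_vertex_halfPlane_in hs h₀ hV hK hin hout hΓ t (by linarith) (by linarith) (Or.inr hd)
  · exact ⟨_, edge_halfPlane hs hV hleft hright hsegΓ t (not_lt.1 hθa) (not_lt.1 hθb)⟩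

include hsegΓ in
/-- The vertices of the cycle are on the cycle. [folklore] -/
theorem vertex_mem_frontier (t : ℕ) :
    triEmbed ((bwalk K d₀ t).1 + triDir (bwalk K d₀ t).2) ∈ frontier (polygonDomain (bverts K 0 1 d₀ Per) hs).carrier :=
  hsegΓ t (right_mem_segment ℝ _ _)

/-- **Near a pin a cycle point sees the upper half-plane** (registered form, sub-goal of
`stub_innerZigzagPolygon`). [folklore] -/
theorem pin_sees_halfPlane : ∀ (K : Finset HexVertex) (d₀ : Site 2 × Fin 6) (Per : ℕ) (hs : IsSimpleClosedPolygon (bverts K 0 1 d₀ Per)) (c y w : ℂ) (Rb : ℝ), 4 ≤ Rb → (polygonDomain (bverts K 0 1 d₀ Per) hs).carrier ∩ Metric.ball c Rb = {w : ℂ | c.im < w.im} ∩ Metric.ball c Rb → ‖y - c‖ < 3 → dist w y ≤ 1 / 8 → w ∈ frontier (polygonDomain (bverts K 0 1 d₀ Per) hs).carrier → (polygonDomain (bverts K 0 1 d₀ Per) hs).carrier ∩ Metric.ball w (1 / 32) = halfPlane 0 w ∩ Metric.ball w (1 / 32) :=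
  fun _ _ _ hs _ _ _ _ hRb hpin hy hwy hw => pin_halfPlane hs hRb hpin hy hwy hw

end Summit.CriticalPhenomena.SAWScalingLimit.Theorems.PolygonParitySqueeze.InnerZigzag

end
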